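import Mathlib
import HarnessLib
import Summits.HubbardSuperconductivity.HubbardSuperconductivity.Theorems.KLProgrammeKLRegimeEngineMeanFreeBaseFrame

/-!
# K3 ENGINE child (stmt-HubbardSuperconductivity-20437), stub (b), (F1)/(c-D) telescope: **`α_w` AT THE MEAN-FREE BASE FRAME** — the
# `klScaleWt`-weighted row and column sums of `S(F̃_nf[μ′, K̊_{m₀}])ᵀ·C^{K̊_{m₀}}_{nf+j}(μ′)·S(F̃_nf[μ′, K̊_{m₀}])` (F1-DESIGN.md §1 «T(m₀)»: the fat family AND
# the slice covariance both on the mean-free frame `K̊_{m₀} = K_{m₀} ⊖ s_{m₀}` at the shifted level `μ′ = μ + s_n`), ONE R-free constant per `(j, d)`,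
# under the stub-(b) binders, from the CURRENT history `HistP … 0 n` and the deep window `4^{m₀+2}·U ≤ 4^{2·nf+d}` at the base depth

Cell `gate-hubbard-kl`, seat p3 (g11); item «MF-BASE» (KL STATUS 2026-08-27 23:45Z), file 2/2; pen (R68e): the (F1)/(c-D) telescope of hubbard-kl-k3c3-p2
starts at the base depth `m₀ = 2(nf+j) + 5 + ⌈log₄|U|⁻¹⌉`, the edge of the R-free window of the derivative route (`…AlphaWtFlowDeep`), so that the tiling
is R-free end to end.  The base is NOT a flow frame (`…EngineMeanFreeBaseFrame`): its band is `frameLevel μ K♯`, `K♯ = K_{m₀} ⊖ Σ_{m₀≤m<n} mean_m`.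

* **`alphaWt_klSliceCov_bgmFat_klEng_meanFreeBase (j d)`** — `∃ Cα > 0`: for every `G P R Q cc` (`R.WF2`, `0 < cc ≤ klEngC₃6 P R`), `μ ∈ klWindowC`,
  `0 < U ≤ klEngU₀3 P R cc / (2¹²·(Gfr₀ + Gfr₁ + Gfr₃ + cr + 1))` (ONE own door of the `…EngineV8DoorGfr` kind, folding `1/(Gfr₃+1)`, the base frame's
  `1/(2¹²(Gfr₀+Gfr₁+cr+1))` and the bumped package's `κ₀/(24(Gfr₀ + cr·klE0 + Gfr₁ + 1))`), `klBetaMin ≤ β ≤ e^{cc/U²}`, `klEngL₃ β U ≤ L`,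
  `klEngM₃ β U L ≤ M`, `n ≤ n_β + 1`, `IsKLRegime U cc (−n)`, `HistP klPredsV17F2 … 0 n`, `1 ≤ m₀ ≤ n`, `1 ≤ nf`, `nf + j ≤ n_β + 1`,
  `4^{m₀+2}·U ≤ 4^{2·nf+d}`, `nf + j ≤ nw`: the weighted row and column sums of `S(F̃_nf[μ,K♯])ᵀ·klSliceCov μ K♯ (nf+j)·S(F̃_nf[μ,K♯])` are
  `≤ Cα·(M/β)/klScale klE0 (nf+j)` — `alphaWt_klSliceCov_bgmFat_of_thresholds` at `(μ, K♯)` with the bumped package `R♭ = ⟨cr, cz, Gfr[0 ↦ Gfr₀ + cr·klE0]⟩`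
  (`frameOK_meanFreeBase`), order-three data = those of `K_{m₀}` (`frameDatum_le_of_pow_window`);
* **`alphaWt_klSliceCov_bgmFat_klEng_meanFreeBase_shifted (j d)`** — the same rows in the (K5′) chain's OWN spelling
  `(μ + −Σ_{m<n} mean_m, K_{m₀} ⊖ (−Σ_{m<m₀} mean_m))` (`nambuXiCT_meanFree_eq_base`, `hubbardCovSliceCT_eq_of_band`).

Everything is proved; no definitions. [cite: BenfattoGiulianiMastropietro2006, §2.8 (2.81), §3 (3.2)–(3.8)]
-/

noncomputable section

namespace Summit.HubbardSuperconductivity.HubbardSuperconductivity.Theorems.TorusFourierL2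

set_option linter.dupNamespace false -- summit = problem name (single-conjunct summit), D-0017

open Set Finset Literature.MathematicalPhysics.QuantumLattice Literature.MathematicalPhysics.QuantumLattice.BandSectorCounting
open Literature.MathematicalPhysics.QuantumLattice.FermiRG Literature.Probability.LatticeModels Literature.Analysis.SpecialFunctions
open Summit.HubbardSuperconductivity.HubbardSuperconductivity.Theorems.DispersionFlow
open Summit.HubbardSuperconductivity.HubbardSuperconductivity.Theorems.KLRegimeSplit
open Summit.HubbardSuperconductivity.HubbardSuperconductivity.Theorems.KLProgrammeLegKernels
open Summit.HubbardSuperconductivity.HubbardSuperconductivity.Theorems.PerturbedFermiCurve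
open Summit.HubbardSuperconductivity.HubbardSuperconductivity.Theorems.KLRegimeWick
open Summit.HubbardSuperconductivity.HubbardSuperconductivity.Theorems.EngineV8
open scoped Real Nat

open Classical

set_option maxHeartbeats 1600000 in -- long regime bookkeeping (same budget as `…AlphaWtFlow`)
/-- **`α_w` at the mean-free base frame `K♯ = K_{m₀} ⊖ Σ_{m₀≤m<n} mean_m`, level `μ`, in the KL regime** (see the module docstring).
[cite: BenfattoGiulianiMastropietro2006, §2.8 (2.81), §3 (3.2)–(3.8)] -/
theorem alphaWt_klSliceCov_bgmFat_klEng_meanFreeBase (j dd : ℕ) :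
    ∃ Cα : ℝ, 0 < Cα ∧
      ∀ (G : GeoConsts) (P : SplitConsts) (R : RenConsts) (Q : EngConsts) (cc : ℝ), R.WF2 → 0 < cc → cc ≤ EngineV8.klEngC₃6 P R →
      ∀ μ ∈ klWindowC, ∀ U : ℝ, 0 < U → U ≤ EngineV8.klEngU₀3 P R cc / (2 ^ 12 * (R.Gfr 0 + R.Gfr 1 + R.Gfr 3 + R.cr + 1)) →
      ∀ β : ℝ, klBetaMin ≤ β → β ≤ Real.exp (cc / U ^ 2) →
      ∀ (L M : ℕ) [NeZero L] [NeZero M], EngineV8.klEngL₃ β U ≤ L → EngineV8.klEngM₃ β U L ≤ M →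
      ∀ n : ℕ, n ≤ nScales β + 1 → IsKLRegime U cc (-(n : ℤ)) → HistP klPredsV17F2 L M G P Q R β U μ 0 n →
        ∀ m₀ : ℕ, 1 ≤ m₀ → m₀ ≤ n →
        ∀ nf : ℕ, 1 ≤ nf → nf + j ≤ nScales β + 1 → (4 : ℝ) ^ (m₀ + 2) * U ≤ (4 : ℝ) ^ (2 * nf + dd) → ∀ nw : ℕ, nf + j ≤ nw →
        (∀ Y : SpaceTimeIdx L M × SectorLeg (sectorCount nf),
          ∑ Y', ‖((sectorSubMatrix L M β (bgmFatMultiplier L M klE0 β (nambuXiCT L μ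
              (fsub (klFlowFrameU L M β U μ m₀) (symInterp L fun _ =>
                ∑ m ∈ Ico m₀ n, klAngularMean (klLocalPart L M β U μ (klFlowFrameU L M β U μ m) m)))) nf)).transpose *
            klSliceCov L M β μ (fsub (klFlowFrameU L M β U μ m₀) (symInterp L fun _ =>
                ∑ m ∈ Ico m₀ n, klAngularMean (klLocalPart L M β U μ (klFlowFrameU L M β U μ m) m))) (nf + j) *
            sectorSubMatrix L M β (bgmFatMultiplier L M klE0 β (nambuXiCT L μ
              (fsub (klFlowFrameU L M β U μ m₀) (symInterp L fun _ =>
                ∑ m ∈ Ico m₀ n, klAngularMean (klLocalPart L M β U μ (klFlowFrameU L M β U μ m) m)))) nf)) Y Y'‖ *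
              EngineV8.klScaleWt L M β nw {EngineV8.latticeLegPos (2 * (2 * M)) Y, EngineV8.latticeLegPos (2 * (2 * M)) Y'} ≤
            Cα * ((M : ℝ) / β) / klScale klE0 (nf + j)) ∧
        (∀ Y' : SpaceTimeIdx L M × SectorLeg (sectorCount nf),
          ∑ Y, ‖((sectorSubMatrix L M β (bgmFatMultiplier L M klE0 β (nambuXiCT L μ
              (fsub (klFlowFrameU L M β U μ m₀) (symInterp L fun _ =>
                ∑ m ∈ Ico m₀ n, klAngularMean (klLocalPart L M β U μ (klFlowFrameU L M β U μ m) m)))) nf)).transpose *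
            klSliceCov L M β μ (fsub (klFlowFrameU L M β U μ m₀) (symInterp L fun _ =>
                ∑ m ∈ Ico m₀ n, klAngularMean (klLocalPart L M β U μ (klFlowFrameU L M β U μ m) m))) (nf + j) *
            sectorSubMatrix L M β (bgmFatMultiplier L M klE0 β (nambuXiCT L μ
              (fsub (klFlowFrameU L M β U μ m₀) (symInterp L fun _ =>
                ∑ m ∈ Ico m₀ n, klAngularMean (klLocalPart L M β U μ (klFlowFrameU L M β U μ m) m)))) nf)) Y Y'‖ *
              EngineV8.klScaleWt L M β nw {EngineV8.latticeLegPos (2 * (2 * M)) Y, EngineV8.latticeLegPos (2 * (2 * M)) Y'} ≤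
            Cα * ((M : ℝ) / β) / klScale klE0 (nf + j)) := by
  have ha : (-4 : ℝ) < -(6 / 5) := by norm_num
  have hab : (-(6 / 5) : ℝ) ≤ -(1 / 10) := by norm_num
  have hb : (-(1 / 10) : ℝ) < 0 := by norm_num
  obtain ⟨Cα, hCα, h⟩ := alphaWt_klSliceCov_bgmFat_of_thresholds ha hab hb j ((4 : ℝ) ^ dd / 3072) (1 / 16 + (4 : ℝ) ^ dd / 3072)
  refine ⟨Cα, hCα, ?_⟩
  intro G P R Q cc hR2 hcc hcc6 μ hμ U hU hUle β hβmin hβc L M _ _ hL3 hM3 n hnN hreg hhist m₀ hm1 hmn nf hnf hnfN hwin nw hnw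
  have hRj : ∀ i, 0 ≤ R.Gfr i := EngineV8.gfr_nonneg_of_wf2 hR2
  have hcr : 0 ≤ R.cr := hR2.1.1
  have he : (0 : ℝ) < klE0 := by norm_num [klE0]
  -- the bumped package of the base frame
  set Rb : RenConsts := ⟨R.cr, R.cz, fun i => if i = 0 then R.Gfr 0 + R.cr * klE0 else R.Gfr i⟩ with hRb
  have hRb0 : Rb.Gfr 0 = R.Gfr 0 + R.cr * klE0 := by simp [hRb]
  have hRbj : ∀ i, i ≠ 0 → Rb.Gfr i = R.Gfr i := fun i hi => by simp [hRb, hi]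
  have hRbnn : ∀ i, 0 ≤ Rb.Gfr i := by
    intro i
    by_cases hi : i = 0
    · subst hi; rw [hRb0]; have := hRj 0; positivity
    · rw [hRbj i hi]; exact hRj i
  -- the `c`-hypothesis (R♭-invariant) and `cc ≤ 1/(480(Gfr₂+1))`
  have hcle := (hcc6.trans (EngineV8.klEngC₃6_le_klEngC₃3 P R)).trans (EngineV8.klEngC₃3_le_symbolC₃ ha hab hb P hRj)
  have hcleb : cc ≤ min (min ((bandBounds ha hab hb).Dtmin / 4) ((bandBounds ha hab hb).rhomin / 4)) (1 / 40) / (12 * (Rb.Gfr 2 + 1)) := by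
    rw [hRbj 2 two_ne_zero]; exact hcle
  have hcc480 : cc ≤ 1 / (480 * (R.Gfr 2 + 1)) := by
    refine hcle.trans ?_
    have hG2 : 0 < 12 * (R.Gfr 2 + 1) := by have := hRj 2; positivity
    rw [div_le_div_iff₀ hG2 (by have := hRj 2; positivity)]
    have hk : min (min ((bandBounds ha hab hb).Dtmin / 4) ((bandBounds ha hab hb).rhomin / 4)) (1 / 40) ≤ 1 / 40 := min_le_right _ _
    nlinarith [hk, hRj 2]
  -- the U-hypotheses from the single door `U ≤ klEngU₀3 P R cc / (2¹²(Gfr₀+Gfr₁+Gfr₃+cr+1))`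
  have hU3R := EngineV8.klEngU₀3_le_symbolU₀ ha hab hb P hRj cc
  set X : ℝ := R.Gfr 0 + R.Gfr 1 + R.Gfr 3 + R.cr with hXdef
  have hX0 : 0 ≤ X := by rw [hXdef]; linarith [hRj 0, hRj 1, hRj 3]
  have hD : (1 : ℝ) ≤ 2 ^ 12 * (X + 1) := by nlinarith [hX0]
  have hE3le1 : EngineV8.klEngU₀3 P R cc ≤ 1 := hU3R.trans (min_le_left _ _)
  have hE3nn : 0 ≤ EngineV8.klEngU₀3 P R cc := by
    have := hU.le.trans hUle
    rw [le_div_iff₀ (by positivity)] at this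
    nlinarith [hU.le, hD]
  have hUE3 : U ≤ EngineV8.klEngU₀3 P R cc := by
    refine hUle.trans ?_
    rw [div_le_iff₀ (by positivity)]
    nlinarith [hE3nn, hD]
  have hU1 : U ≤ 1 := hUE3.trans hE3le1
  have hUX : U ≤ 1 / (2 ^ 12 * (X + 1)) := hUle.trans (div_le_div_of_nonneg_right hE3le1 (by positivity))
  have hUd : U ≤ 1 / (2 ^ 12 * (R.Gfr 0 + R.Gfr 1 + R.cr + 1)) := by
    refine hUX.trans ?_
    rw [hXdef]
    exact one_div_le_one_div_of_le (by have := hRj 0; have := hRj 1; positivity) (by nlinarith [hRj 3])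
  have hGU : R.Gfr 3 * U ≤ 1 := by
    have h1 : R.Gfr 3 * U ≤ R.Gfr 3 * (1 / (2 ^ 12 * (X + 1))) := mul_le_mul_of_nonneg_left hUX (hRj 3)
    refine h1.trans ?_
    rw [← mul_div_assoc, mul_one, div_le_one (by positivity), hXdef]
    nlinarith [hRj 0, hRj 1, hRj 3, hcr]
  have hU3b : U ≤ min 1 (min (min ((bandBounds ha hab hb).Dtmin / 4) ((bandBounds ha hab hb).rhomin / 4)) (1 / 40) /
      (24 * (Rb.Gfr 0 + Rb.Gfr 1 + 1))) := by
    rw [hRb0, hRbj 1 one_ne_zero]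
    set κ : ℝ := min (min ((bandBounds ha hab hb).Dtmin / 4) ((bandBounds ha hab hb).rhomin / 4)) (1 / 40) with hκ
    have hκ0 : 0 < κ := by
      rw [hκ]; have := (bandBounds ha hab hb).Dtmin_pos; have := (bandBounds ha hab hb).rhomin_pos
      exact lt_min (lt_min (by positivity) (by positivity)) (by norm_num)
    refine le_min hU1 ?_
    -- `U·2¹²(X+1) ≤ klEngU₀3 ≤ κ/(24(Gfr₀+Gfr₁+1))` and `(Gfr₀+Gfr₁+1)·2¹²(X+1) ≥ Gfr₀ + cr·klE0 + Gfr₁ + 1`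
    have h1 : U * (2 ^ 12 * (X + 1)) ≤ κ / (24 * (R.Gfr 0 + R.Gfr 1 + 1)) := by
      have := hUle; rw [le_div_iff₀ (by positivity)] at this
      exact this.trans (hU3R.trans (min_le_right _ _))
    have hA0 : 0 < R.Gfr 0 + R.Gfr 1 + 1 := by linarith [hRj 0, hRj 1]
    have hB0 : 0 < R.Gfr 0 + R.cr * klE0 + R.Gfr 1 + 1 := by have := hRj 0; have := hRj 1; positivity
    rw [le_div_iff₀ (by positivity)]
    rw [le_div_iff₀ (by positivity)] at h1
    have hcmp : 24 * (R.Gfr 0 + R.cr * klE0 + R.Gfr 1 + 1) ≤ 24 * (R.Gfr 0 + R.Gfr 1 + 1) * (2 ^ 12 * (X + 1)) := by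
      have he1 : klE0 ≤ 1 := by norm_num [klE0]
      rw [hXdef]; nlinarith [hRj 0, hRj 1, hRj 3, hcr, he.le, he1]
    calc U * (24 * (R.Gfr 0 + R.cr * klE0 + R.Gfr 1 + 1)) ≤ U * (24 * (R.Gfr 0 + R.Gfr 1 + 1) * (2 ^ 12 * (X + 1))) :=
          mul_le_mul_of_nonneg_left hcmp hU.le
      _ = U * (2 ^ 12 * (X + 1)) * (24 * (R.Gfr 0 + R.Gfr 1 + 1)) := by ring
      _ ≤ κ := h1
  have hLβ : β ^ 2 ≤ (L : ℝ) := EngineV8.sq_le_of_klEngL₃_le hL3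
  have hMβ : β ≤ (M : ℝ) := EngineV8.le_of_klEngM₃_le hβmin hL3 hM3
  -- the base frame and its admissibility
  set Kb : TrigPolyC4v := fsub (klFlowFrameU L M β U μ m₀) (symInterp L fun _ =>
    ∑ m ∈ Ico m₀ n, klAngularMean (klLocalPart L M β U μ (klFlowFrameU L M β U μ m) m)) with hKb
  have hfr : FrameOK Rb U (nScales β) μ Kb := frameOK_meanFreeBase hR2 hμ hU hU1 hUd hcc.le hcc480 hreg hm1 hmn hnN hhist
  -- the order-three data: those of the flow frame `K_{m₀}` (the subtracted constant is invisible), from the history below `m₀`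
  obtain ⟨N, rfl⟩ : ∃ N, m₀ = N + 1 := ⟨m₀ - 1, by omega⟩
  have hh := (histP_klPredsV17F2_iff L M G P Q R β U μ 0 n).1 hhist
  have hJets : ∀ m ≤ N, FlowPieceJetsAt L M β U μ R m := fun m hm => (hh m (by omega)).2.1.2.1
  have hJets' : ∀ m < N + 1, FlowPieceJetsAt L M β U μ R m := fun m hm => hJets m (Nat.le_of_lt_succ hm)
  have hGeo : FlowGeometryAt L M β U μ N := (hh N (by omega)).2.1.2.2
  have hK1 : FrameOK R U N μ (klFlowFrameU L M β U μ (N + 1)) := frameOK_klFlowFrameU_succ hJets hGeo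
  have hA3 : ∀ p : Momentum, ‖iteratedFDeriv ℝ 3 (frameShift Kb) p‖ ≤ R.Gfr 3 * U ^ 2 * ((4 : ℝ) ^ (N + 1) / 3) := by
    intro p
    rw [hKb, iteratedFDeriv_frameShift_fsub_symInterp_const _ _ (by norm_num)]
    exact (frameShift_high_sizes_of_frameOK hRj hK1).1 p
  have hsum : ∑ m' ∈ range (N + 1), R.Gfr 3 * uPow 3 U * (4 : ℝ) ^ ((((3 : ℕ) : ℤ) - 2) * m') ≤ R.Gfr 3 * U ^ 2 * ((4 : ℝ) ^ (N + 1) / 3) := by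
    have e3 : uPow 3 U = U ^ 2 := by rw [show (3 : ℕ) = 2 + 1 by rfl, uPow_succ]
    have hterm : ∀ m' : ℕ, (4 : ℝ) ^ ((((3 : ℕ) : ℤ) - 2) * (m' : ℤ)) = (4 : ℝ) ^ m' := by
      intro m'
      rw [show (((3 : ℕ) : ℤ) - 2) * (m' : ℤ) = ((m' : ℕ) : ℤ) by push_cast; ring, zpow_natCast]
    have hgeom : ∀ k : ℕ, ∑ m' ∈ range k, (4 : ℝ) ^ m' ≤ (4 : ℝ) ^ k / 3 := by
      intro k
      induction k with
      | zero => simp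
      | succ k ih => rw [Finset.sum_range_succ, pow_succ]; linarith
    calc ∑ m' ∈ range (N + 1), R.Gfr 3 * uPow 3 U * (4 : ℝ) ^ ((((3 : ℕ) : ℤ) - 2) * m')
        = R.Gfr 3 * U ^ 2 * ∑ m' ∈ range (N + 1), (4 : ℝ) ^ m' := by
          rw [Finset.mul_sum]; exact Finset.sum_congr rfl fun m' _ => by rw [e3, hterm]
      _ ≤ R.Gfr 3 * U ^ 2 * ((4 : ℝ) ^ (N + 1) / 3) := mul_le_mul_of_nonneg_left (hgeom (N + 1)) (by have := hRj 3; positivity)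
  have hK3 : ∀ p : Momentum, ‖iteratedFDeriv ℝ 3 (frameLevel μ Kb) p‖ ≤ 64 + R.Gfr 3 * U ^ 2 * ((4 : ℝ) ^ (N + 1) / 3) := by
    intro p
    rw [hKb, iteratedFDeriv_frameLevel_fsub_symInterp_const _ _ _ (by norm_num)]
    have h0 := norm_iteratedFDeriv_frameLevel_klFlowFrameU_le (L := L) (M := M) (β := β) (U := U) (μ := μ) (i := 3) (by norm_num) (by norm_num)
      hJets' p
    have e64 : (4 : ℝ) ^ (3 : ℕ) = 64 := by norm_num
    rw [e64] at h0
    exact h0.trans (by linarith only [hsum])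
  -- the data on the deep window at the base depth
  have hdatA : R.Gfr 3 * U ^ 2 * ((4 : ℝ) ^ (N + 1) / 3) * klScale klE0 (nf - 1) ^ 2 ≤ (4 : ℝ) ^ dd / 3072 :=
    frameDatum_le_of_pow_window hU.le hGU hnf hwin
  have hdatK : (64 + R.Gfr 3 * U ^ 2 * ((4 : ℝ) ^ (N + 1) / 3)) * klScale klE0 (nf + j) ^ 2 ≤ 1 / 16 + (4 : ℝ) ^ dd / 3072 := by
    have hΛle : klScale klE0 (nf + j) ≤ klScale klE0 (nf - 1) := EngineV8.klScale_le_klScale (by norm_num [klE0]) (by omega)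
    have hΛe : klScale klE0 (nf + j) ≤ 1 / 32 := by
      have := klScale_le_e0 (show (0 : ℝ) ≤ klE0 by norm_num [klE0]) (nf + j); rwa [show klE0 = 1 / 32 from rfl] at this
    have hΛ0 : 0 ≤ klScale klE0 (nf + j) := (klth_klScale_pos _).le
    have h1 : 64 * klScale klE0 (nf + j) ^ 2 ≤ 1 / 16 := by nlinarith [hΛe, hΛ0]
    have h2 : R.Gfr 3 * U ^ 2 * ((4 : ℝ) ^ (N + 1) / 3) * klScale klE0 (nf + j) ^ 2 ≤ (4 : ℝ) ^ dd / 3072 := by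
      refine le_trans ?_ hdatA
      have h0 : 0 ≤ R.Gfr 3 * U ^ 2 * ((4 : ℝ) ^ (N + 1) / 3) := by have := hRj 3; positivity
      exact mul_le_mul_of_nonneg_left (pow_le_pow_left₀ hΛ0 hΛle 2) h0
    nlinarith only [h1, h2]
  exact h Rb hRbnn cc U hcc hcleb hU hU3b β hβmin hβc μ hμ Kb hfr _ _ hA3 hK3 L M hLβ hMβ nf hnf hnfN hdatA hdatK nw hnw

/-- **The same base rows in the (K5′) chain's own spelling** — level `μ′ = μ + (−Σ_{m<n} mean_m)`, mean-free frame `K̊_{m₀} = K_{m₀} ⊖ (−Σ_{m<m₀} mean_m)`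
(as in hubbard-kl-k3c3-p2's `…EngineSliceSpaceMomentOscCD`): the fat family `F̃_nf[μ′, K̊_{m₀}]` and the slice `klSliceCov μ′ K̊_{m₀} (nf+j)` ARE the ones at
`(μ, K♯)` (`nambuXiCT_meanFree_eq_base`, `hubbardCovSliceCT_eq_of_band`). Same constant, same binders. [cite: BenfattoGiulianiMastropietro2006, §2.8 (2.81), §3 (3.2)–(3.8)] -/
theorem alphaWt_klSliceCov_bgmFat_klEng_meanFreeBase_shifted (j dd : ℕ) :
    ∃ Cα : ℝ, 0 < Cα ∧
      ∀ (G : GeoConsts) (P : SplitConsts) (R : RenConsts) (Q : EngConsts) (cc : ℝ), R.WF2 → 0 < cc → cc ≤ EngineV8.klEngC₃6 P R →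
      ∀ μ ∈ klWindowC, ∀ U : ℝ, 0 < U → U ≤ EngineV8.klEngU₀3 P R cc / (2 ^ 12 * (R.Gfr 0 + R.Gfr 1 + R.Gfr 3 + R.cr + 1)) →
      ∀ β : ℝ, klBetaMin ≤ β → β ≤ Real.exp (cc / U ^ 2) →
      ∀ (L M : ℕ) [NeZero L] [NeZero M], EngineV8.klEngL₃ β U ≤ L → EngineV8.klEngM₃ β U L ≤ M →
      ∀ n : ℕ, n ≤ nScales β + 1 → IsKLRegime U cc (-(n : ℤ)) → HistP klPredsV17F2 L M G P Q R β U μ 0 n →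
        ∀ m₀ : ℕ, 1 ≤ m₀ → m₀ ≤ n →
        ∀ nf : ℕ, 1 ≤ nf → nf + j ≤ nScales β + 1 → (4 : ℝ) ^ (m₀ + 2) * U ≤ (4 : ℝ) ^ (2 * nf + dd) → ∀ nw : ℕ, nf + j ≤ nw →
        (∀ Y : SpaceTimeIdx L M × SectorLeg (sectorCount nf),
          ∑ Y', ‖((sectorSubMatrix L M β (bgmFatMultiplier L M klE0 β (nambuXiCT L
              (μ + -(∑ m ∈ range n, klAngularMean (klLocalPart L M β U μ (klFlowFrameU L M β U μ m) m)))
              (fsub (klFlowFrameU L M β U μ m₀) (symInterp L fun _ =>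
                -(∑ m ∈ range m₀, klAngularMean (klLocalPart L M β U μ (klFlowFrameU L M β U μ m) m))))) nf)).transpose *
            klSliceCov L M β (μ + -(∑ m ∈ range n, klAngularMean (klLocalPart L M β U μ (klFlowFrameU L M β U μ m) m)))
              (fsub (klFlowFrameU L M β U μ m₀) (symInterp L fun _ =>
                -(∑ m ∈ range m₀, klAngularMean (klLocalPart L M β U μ (klFlowFrameU L M β U μ m) m)))) (nf + j) *
            sectorSubMatrix L M β (bgmFatMultiplier L M klE0 β (nambuXiCT L
              (μ + -(∑ m ∈ range n, klAngularMean (klLocalPart L M β U μ (klFlowFrameU L M β U μ m) m)))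
              (fsub (klFlowFrameU L M β U μ m₀) (symInterp L fun _ =>
                -(∑ m ∈ range m₀, klAngularMean (klLocalPart L M β U μ (klFlowFrameU L M β U μ m) m))))) nf)) Y Y'‖ *
              EngineV8.klScaleWt L M β nw {EngineV8.latticeLegPos (2 * (2 * M)) Y, EngineV8.latticeLegPos (2 * (2 * M)) Y'} ≤
            Cα * ((M : ℝ) / β) / klScale klE0 (nf + j)) ∧
        (∀ Y' : SpaceTimeIdx L M × SectorLeg (sectorCount nf),
          ∑ Y, ‖((sectorSubMatrix L M β (bgmFatMultiplier L M klE0 β (nambuXiCT L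
              (μ + -(∑ m ∈ range n, klAngularMean (klLocalPart L M β U μ (klFlowFrameU L M β U μ m) m)))
              (fsub (klFlowFrameU L M β U μ m₀) (symInterp L fun _ =>
                -(∑ m ∈ range m₀, klAngularMean (klLocalPart L M β U μ (klFlowFrameU L M β U μ m) m))))) nf)).transpose *
            klSliceCov L M β (μ + -(∑ m ∈ range n, klAngularMean (klLocalPart L M β U μ (klFlowFrameU L M β U μ m) m)))
              (fsub (klFlowFrameU L M β U μ m₀) (symInterp L fun _ =>
                -(∑ m ∈ range m₀, klAngularMean (klLocalPart L M β U μ (klFlowFrameU L M β U μ m) m)))) (nf + j) *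
            sectorSubMatrix L M β (bgmFatMultiplier L M klE0 β (nambuXiCT L
              (μ + -(∑ m ∈ range n, klAngularMean (klLocalPart L M β U μ (klFlowFrameU L M β U μ m) m)))
              (fsub (klFlowFrameU L M β U μ m₀) (symInterp L fun _ =>
                -(∑ m ∈ range m₀, klAngularMean (klLocalPart L M β U μ (klFlowFrameU L M β U μ m) m))))) nf)) Y Y'‖ *
              EngineV8.klScaleWt L M β nw {EngineV8.latticeLegPos (2 * (2 * M)) Y, EngineV8.latticeLegPos (2 * (2 * M)) Y'} ≤
            Cα * ((M : ℝ) / β) / klScale klE0 (nf + j)) := by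
  obtain ⟨Cα, hCα, h⟩ := alphaWt_klSliceCov_bgmFat_klEng_meanFreeBase j dd
  refine ⟨Cα, hCα, ?_⟩
  intro G P R Q cc hR2 hcc hcc6 μ hμ U hU hUle β hβmin hβc L M _ _ hL3 hM3 n hnN hreg hhist m₀ hm1 hmn nf hnf hnfN hwin nw hnw
  have e1 := nambuXiCT_meanFree_eq_base (L := L) (M := M) β U μ hmn
  have e2 : klSliceCov L M β (μ + -(∑ m ∈ range n, klAngularMean (klLocalPart L M β U μ (klFlowFrameU L M β U μ m) m)))
        (fsub (klFlowFrameU L M β U μ m₀) (symInterp L fun _ =>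
          -(∑ m ∈ range m₀, klAngularMean (klLocalPart L M β U μ (klFlowFrameU L M β U μ m) m)))) (nf + j) =
      klSliceCov L M β μ (fsub (klFlowFrameU L M β U μ m₀) (symInterp L fun _ =>
          ∑ m ∈ Ico m₀ n, klAngularMean (klLocalPart L M β U μ (klFlowFrameU L M β U μ m) m))) (nf + j) := by
    simp only [klSliceCov]
    exact hubbardCovSliceCT_eq_of_band _ _ _ _ e1
  rw [e1, e2]
  exact h G P R Q cc hR2 hcc hcc6 μ hμ U hU hUle β hβmin hβc L M hL3 hM3 n hnN hreg hhist m₀ hm1 hmn nf hnf hnfN hwin nw hnw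

end Summit.HubbardSuperconductivity.HubbardSuperconductivity.Theorems.TorusFourierL2

end
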